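import Summits.KontsevichZagierPeriods.KontsevichZagierPeriods.Theorems.RootDecompRelativeModAbsoluteRegFoldingDegOneP14
import Literature.ModelTheory.ExponentialFields.SemialgebraicC1TriangulationProofs

/-!
# NODE g10 — companion file: the analytic leaf `OneVarPowerBounds` is a THEOREM

`decomp-kz-lens-3`, generation 10 (planner-decomp-kz-lens-3-g10-0), 2026-08-30.  Companion to
`CylLogSplit.lean` §4: the leaf `OneVarPowerBounds` (power bounds for one-variable `ℚ`-semialgebraic
functions at an endpoint) is re-declared here VERBATIM (same text as `CylLog.OneVarPowerBounds`; the two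
`Prop`s are syntactically identical) and PROVED from the tree's growth dichotomy for semialgebraic
one-variable functions (`Literature.ModelTheory.ExponentialFields.exists_mul_pow_le_abs_of_isSemialgebraic_graph`,
`exists_abs_pow_le_mul_of_tendsto` — HaPham2016 Lemma 1.7 / OhmotoShiota2017 Lemma 3.5, file
`SemialgebraicC1TriangulationProofs`).  It lives in a separate file only because adding that import to the
2600-line main file forces a cold re-elaboration beyond the farm's transport timeout; nothing else differs.

Proof: translate `a ↦ 0⁺` along the polynomial map `s ↦ s + a` (`comp_isSemialgebraicMapOn_holds`,
`isSemialgebraicMapOn_aeval`, `real_of`); the negative-power bound is the LOWER growth bound of `1/φ` on the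
semialgebraic piece `{|φ| ≥ 1}` (`isSemialgebraic_sep_nonneg`, `.inv`, `isSemialgebraic_graph_of_isSemialgebraicFunOn`);
the positive rational power is the UPPER bound `|φ|^m ≤ C·s` (`Real.pow_rpow_inv_natCast`, `Real.mul_rpow`).
-/

open Set MeasureTheory Filter Topology
open Literature.NumberTheory.Transcendental Literature.ModelTheory.ExponentialFields

namespace Summit.KontsevichZagierPeriods.RootDecompRelativeModAbsolute.Rung30571.RegularisedLogLayer.CylLogLeaf

/-- **`OneVarPowerBounds`** — verbatim the leaf of `CylLogSplit.lean` §4 (same text). -/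
def OneVarPowerBounds : Prop :=
  ∀ (φ : ℝ → ℝ) (a c : ℝ), a < c →
    IsSemialgebraicFunOn ℚ {x : Fin 1 → ℝ | x 0 ∈ Set.Ioo a c} (fun x => φ (x 0)) →
    (∃ (K : ℕ) (C δ : ℝ), 0 < δ ∧ ∀ t ∈ Set.Ioo a (a + δ), |φ t| ≤ C * (t - a) ^ (-(K : ℤ))) ∧
    (Tendsto φ (𝓝[>] a) (𝓝 0) →
      ∃ (N : ℕ) (C δ : ℝ), 0 < N ∧ 0 < δ ∧ ∀ t ∈ Set.Ioo a (a + δ), |φ t| ≤ C * (t - a) ^ ((N : ℝ)⁻¹))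

/-- Translating one-variable `ℚ`-semialgebraic data to `0⁺` (real coefficients): `x ↦ φ (x₀ + a)` is
real-semialgebraic on `{x₀ ∈ (0, c − a)}`. -/
theorem isSemialgebraicFunOn_translate {φ : ℝ → ℝ} {a c : ℝ}
    (hφ : IsSemialgebraicFunOn ℚ {x : Fin 1 → ℝ | x 0 ∈ Set.Ioo a c} (fun x => φ (x 0))) :
    IsSemialgebraicFunOn ℝ {x : Fin 1 → ℝ | x 0 ∈ Ioo 0 (c - a)} (fun x => φ (x 0 + a)) := by
  have hφR := hφ.real_of
  have hS' : IsSemialgebraic ℝ {x : Fin 1 → ℝ | x 0 ∈ Ioo 0 (c - a)} :=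
    SemialgebraicMonotonicity.sa_mem_Ioo 0 0 (c - a)
  have hf : IsSemialgebraicMapOn ℝ {x : Fin 1 → ℝ | x 0 ∈ Ioo 0 (c - a)}
      (fun x (j : Fin 1) => MvPolynomial.aeval x
        ((fun _ => (MvPolynomial.X 0 + MvPolynomial.C a : MvPolynomial (Fin 1) ℝ)) j)) :=
    isSemialgebraicMapOn_aeval hS' _
  have hf' : IsSemialgebraicMapOn ℝ {x : Fin 1 → ℝ | x 0 ∈ Ioo 0 (c - a)}
      (fun x (_ : Fin 1) => x 0 + a) :=
    hf.congr fun x _ => by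
      funext j
      simp
  have hst : MapsTo (fun (x : Fin 1 → ℝ) (_ : Fin 1) => x 0 + a)
      {x : Fin 1 → ℝ | x 0 ∈ Ioo 0 (c - a)} {x : Fin 1 → ℝ | x 0 ∈ Ioo a c} := by
    intro x hx
    simp only [mem_setOf_eq, mem_Ioo] at hx ⊢
    constructor <;> linarith [hx.1, hx.2]
  exact (IsSemialgebraicFunOn.comp_isSemialgebraicMapOn_holds hφR hf' hst).congr fun _ _ => rfl

/-- The real-semialgebraic graph of the translate `s ↦ φ (s + a)` over a subset cut out by the sign of
`±φ − 1` (where `|φ| ≥ 1`), carrying the reciprocal. -/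
theorem isSemialgebraic_graph_inv_translate {φ : ℝ → ℝ} {a c : ℝ}
    (hφ : IsSemialgebraicFunOn ℚ {x : Fin 1 → ℝ | x 0 ∈ Set.Ioo a c} (fun x => φ (x 0))) :
    IsSemialgebraic ℝ {w : Fin 2 → ℝ |
      w 0 ∈ {s : ℝ | s ∈ Ioo 0 (c - a) ∧ (0 ≤ φ (s + a) - 1 ∨ 0 ≤ -φ (s + a) - 1)} ∧
      w 1 = (φ (w 0 + a))⁻¹} := by
  have hψ := isSemialgebraicFunOn_translate hφ
  have hS' : IsSemialgebraic ℝ {x : Fin 1 → ℝ | x 0 ∈ Ioo 0 (c - a)} :=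
    SemialgebraicMonotonicity.sa_mem_Ioo 0 0 (c - a)
  have h1 : IsSemialgebraicFunOn ℝ {x : Fin 1 → ℝ | x 0 ∈ Ioo 0 (c - a)} (fun _ => (1:ℝ)) :=
    (isSemialgebraicFunOn_aeval hS' (MvPolynomial.C 1)).congr fun _ _ => by simp
  have hT₁ : IsSemialgebraic ℝ ({x | x ∈ {x : Fin 1 → ℝ | x 0 ∈ Ioo 0 (c - a)} ∧
      0 ≤ φ (x 0 + a) - 1} ∪ {x | x ∈ {x : Fin 1 → ℝ | x 0 ∈ Ioo 0 (c - a)} ∧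
      0 ≤ -φ (x 0 + a) - 1}) :=
    (IsSemialgebraicFunOn.isSemialgebraic_sep_nonneg (IsSemialgebraicFunOn.sub_holds hψ h1)).union
      (IsSemialgebraicFunOn.isSemialgebraic_sep_nonneg (IsSemialgebraicFunOn.sub_holds hψ.neg h1))
  have hset : ({x | x ∈ {x : Fin 1 → ℝ | x 0 ∈ Ioo 0 (c - a)} ∧ 0 ≤ φ (x 0 + a) - 1} ∪
      {x | x ∈ {x : Fin 1 → ℝ | x 0 ∈ Ioo 0 (c - a)} ∧ 0 ≤ -φ (x 0 + a) - 1}) =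
      {t : Fin 1 → ℝ | t 0 ∈ {s : ℝ | s ∈ Ioo 0 (c - a) ∧ (0 ≤ φ (s + a) - 1 ∨ 0 ≤ -φ (s + a) - 1)}} := by
    ext x
    simp only [mem_union, mem_setOf_eq]
    tauto
  have hsub : {t : Fin 1 → ℝ | t 0 ∈ {s : ℝ | s ∈ Ioo 0 (c - a) ∧
      (0 ≤ φ (s + a) - 1 ∨ 0 ≤ -φ (s + a) - 1)}} ⊆ {x : Fin 1 → ℝ | x 0 ∈ Ioo 0 (c - a)} :=
    fun x hx => hx.1
  have hψT := hψ.mono hsub (hset ▸ hT₁)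
  have hne : ∀ x ∈ {t : Fin 1 → ℝ | t 0 ∈ {s : ℝ | s ∈ Ioo 0 (c - a) ∧
      (0 ≤ φ (s + a) - 1 ∨ 0 ≤ -φ (s + a) - 1)}}, φ (x 0 + a) ≠ 0 := by
    intro x hx h0
    rcases hx.2 with h | h <;> linarith
  exact isSemialgebraic_graph_of_isSemialgebraicFunOn (f := fun s => (φ (s + a))⁻¹) (hψT.inv hne)

/-- Auxiliary step `oneVarPowerBounds_holds`. [bookkeeping] -/
theorem oneVarPowerBounds_holds : OneVarPowerBounds := by
  intro φ a c hac hφ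
  have hca : 0 < c - a := sub_pos.mpr hac
  have hψ := isSemialgebraicFunOn_translate hφ
  have hG : IsSemialgebraic ℝ {w : Fin 2 → ℝ | w 0 ∈ Ioo 0 (c - a) ∧ w 1 = φ (w 0 + a)} :=
    isSemialgebraic_graph_of_isSemialgebraicFunOn (f := fun s => φ (s + a)) hψ
  refine ⟨?_, fun hT => ?_⟩
  · -- a negative power bounds `φ`: lower growth of `1/φ(· + a)` where `|φ| ≥ 1`
    have hG₁ := isSemialgebraic_graph_inv_translate hφ
    have hne : ∀ t ∈ {s : ℝ | s ∈ Ioo 0 (c - a) ∧ (0 ≤ φ (s + a) - 1 ∨ 0 ≤ -φ (s + a) - 1)},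
        (φ (t + a))⁻¹ ≠ 0 := by
      intro t ht
      apply inv_ne_zero
      intro h0
      rcases ht.2 with h | h <;> linarith
    obtain ⟨m, c₀, δ, hc₀, hδ, hlow⟩ := exists_mul_pow_le_abs_of_isSemialgebraic_graph hG₁ hne
    refine ⟨m, max c₀⁻¹ 1, min δ (min 1 (c - a)), lt_min hδ (lt_min one_pos hca), fun t ht => ?_⟩
    obtain ⟨hat, htδ⟩ := ht
    set s := t - a with hs_def
    have hs0 : 0 < s := by rw [hs_def]; linarith
    have hsδ : s < δ := by
      have := min_le_left δ (min 1 (c - a)); rw [hs_def]; linarith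
    have hs1 : s < 1 := by
      have := (min_le_right δ (min 1 (c - a))).trans (min_le_left 1 (c - a)); rw [hs_def]; linarith
    have hsc : s < c - a := by
      have := (min_le_right δ (min 1 (c - a))).trans (min_le_right 1 (c - a)); rw [hs_def]; linarith
    have hts : t = s + a := by rw [hs_def]; ring
    have hpow_pos : 0 < s ^ m := pow_pos hs0 m
    have hzpow : (t - a) ^ (-(m : ℤ)) = (s ^ m)⁻¹ := by
      rw [← hs_def, zpow_neg, zpow_natCast]
    have hinv1 : 1 ≤ (s ^ m)⁻¹ := (one_le_inv₀ hpow_pos).2 (pow_le_one₀ hs0.le hs1.le)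
    have hC1 : (1 : ℝ) ≤ max c₀⁻¹ 1 := le_max_right _ _
    rw [hzpow, hts]
    by_cases hbig : 1 ≤ |φ (s + a)|
    · have hmem : s ∈ {s : ℝ | s ∈ Ioo 0 (c - a) ∧ (0 ≤ φ (s + a) - 1 ∨ 0 ≤ -φ (s + a) - 1)} := by
        refine ⟨⟨hs0, hsc⟩, ?_⟩
        rcases le_abs'.mp hbig with h | h
        · exact Or.inr (by linarith)
        · exact Or.inl (by linarith)
      have h := hlow s hmem hs0 hsδ
      rw [abs_inv] at h
      have hφpos : 0 < |φ (s + a)| := lt_of_lt_of_le one_pos hbig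
      -- |φ| ≤ (c₀ s^m)⁻¹ = c₀⁻¹ (s^m)⁻¹
      have h2 : |φ (s + a)| ≤ (c₀ * s ^ m)⁻¹ := by
        have := inv_anti₀ (by positivity) h
        rwa [inv_inv] at this
      calc |φ (s + a)| ≤ (c₀ * s ^ m)⁻¹ := h2
        _ = c₀⁻¹ * (s ^ m)⁻¹ := by rw [mul_inv]
        _ ≤ max c₀⁻¹ 1 * (s ^ m)⁻¹ :=
          mul_le_mul_of_nonneg_right (le_max_left _ _) (inv_nonneg.mpr hpow_pos.le)
    · push Not at hbig
      calc |φ (s + a)| ≤ 1 := hbig.le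
        _ ≤ (s ^ m)⁻¹ := hinv1
        _ ≤ max c₀⁻¹ 1 * (s ^ m)⁻¹ :=
          le_mul_of_one_le_left (inv_nonneg.mpr hpow_pos.le) hC1
  · -- `φ → 0`: upper growth `|φ(· + a)|^m ≤ C s`
    have h1 : Tendsto (fun s : ℝ => s + a) (𝓝[>] 0) (𝓝[>] a) := by
      have hc : Continuous fun s : ℝ => s + a := by fun_prop
      have h := (hc.continuousWithinAt (s := Ioi (0:ℝ)) (x := 0)).tendsto_nhdsWithin
        (t := Ioi a) (fun s hs => lt_add_of_pos_left a hs)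
      rwa [zero_add] at h
    have hψT : Tendsto (fun s => φ (s + a)) (𝓝[>] 0) (𝓝 0) := hT.comp h1
    obtain ⟨m, C, δ, hm, hδ, hup⟩ := exists_abs_pow_le_mul_of_tendsto hca hG hψT
    have hm0 : m ≠ 0 := by omega
    refine ⟨m, (max C 1) ^ ((m : ℝ)⁻¹), δ, by omega, hδ, fun t ht => ?_⟩
    obtain ⟨hat, htδ⟩ := ht
    set s := t - a with hs_def
    have hs0 : 0 < s := by rw [hs_def]; linarith
    have hsδ : s < δ := by rw [hs_def]; linarith
    have hts : t = s + a := by rw [hs_def]; ring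
    have h := hup s ⟨hs0, hsδ⟩
    have hC1 : 0 ≤ max C 1 := le_trans zero_le_one (le_max_right _ _)
    have h' : |φ (s + a)| ^ m ≤ max C 1 * s :=
      h.trans (mul_le_mul_of_nonneg_right (le_max_left _ _) hs0.le)
    have hminv : 0 ≤ ((m : ℝ))⁻¹ := inv_nonneg.mpr (Nat.cast_nonneg m)
    rw [hts]
    calc |φ (s + a)| = (|φ (s + a)| ^ m) ^ ((m : ℝ)⁻¹) :=
          (Real.pow_rpow_inv_natCast (abs_nonneg _) hm0).symm
      _ ≤ (max C 1 * s) ^ ((m : ℝ)⁻¹) :=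
          Real.rpow_le_rpow (pow_nonneg (abs_nonneg _) m) h' hminv
      _ = (max C 1) ^ ((m : ℝ)⁻¹) * s ^ ((m : ℝ)⁻¹) := Real.mul_rpow hC1 hs0.le

end Summit.KontsevichZagierPeriods.RootDecompRelativeModAbsolute.Rung30571.RegularisedLogLayer.CylLogLeaf
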